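import Summits.AtomisticToContinuum.FouriersLaw.Theorems.SubBallisticWindow.Negative.ClosedFlow
import Summits.AtomisticToContinuum.FouriersLaw.Theorems.BondHeatUncertaintyLightConeBondHeatVirialAlgebra
import Summits.AtomisticToContinuum.FouriersLaw.Theorems.OddSectorIrreversibilityWitnessGlueClosedFlow

/-!
# `SubBallisticWindow` / line `Sketch`: the return-ramp corrector (`stub_rampCorrector`)

Support file for crux `stmt-AtomisticToContinuum-14070` (route `OddSectorIrreversibility`, E2): given the Poincaré
inequality for `μ = e^{-H/T} dq dp`, `N`-uniform per-site moments and the `N`-uniform static block-current bound, the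
weighted site energy `W_w` (`Negative.ClosedFlow.weightedEnergy`) of the RETURN RAMP
`w_k = (min(k,k₂) ∸ k₁) - (ℓ/M)(min(k,k₂+M) ∸ k₂)`, `M = ⌊τ⌋₊`, achieves `8 Var + 2τ² ∫(J_B - {H,W_w})² ≤ C ℓ²(ℓ+τ) Z`
uniformly in `N` (`{H,W_w} = J_B - (ℓ/M) J_{[k₂,k₂+M)}`, `∫|∇W_w|² ≲ ∑ w_k² Z ≤ ℓ²(ℓ+M) Z`, `2τ²(ℓ/M)² C_J M ≤ 4C_J ℓ²τ`).
-/

noncomputable section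

namespace Summit.AtomisticToContinuum.FouriersLaw.Theorems.SubBallisticWindow.RampCorrector

open MeasureTheory Filter Topology Set
open scoped NNReal ENNReal ContDiff
open Literature.MathematicalPhysics.KineticTheory.HeatConduction
open Summit.AtomisticToContinuum.FouriersLaw.Theorems.SubBallisticWindow.Negative.ClosedFlow
open Summit.AtomisticToContinuum.FouriersLaw.Theorems.OddSectorWitness
open Summit.AtomisticToContinuum.FouriersLaw.Theorems.LightConeBondHeat
open Summit.AtomisticToContinuum.FouriersLaw.Theorems.SubdiffusiveBondHeat

/-- Gradient of the return ramp: `w_{k+1} - w_k = 1_{[k₁,k₂)}(k) - c·1_{[k₂,k₂+M)}(k)`. [folklore] -/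
theorem ramp_grad (k₁ k₂ M : ℕ) (c : ℝ) (k : ℕ) :
    (((min (k + 1) k₂ - k₁ : ℕ) : ℝ) - c * ((min (k + 1) (k₂ + M) - k₂ : ℕ) : ℝ)) -
      (((min k k₂ - k₁ : ℕ) : ℝ) - c * ((min k (k₂ + M) - k₂ : ℕ) : ℝ)) =
    (if k₁ ≤ k ∧ k < k₂ then 1 else 0) - c * (if k₂ ≤ k ∧ k < k₂ + M then 1 else 0) := by
  -- adapted from Cruxes/SubBallisticWindow/Disproof.lean (`blockWeight_succ_sub`)
  have h : ∀ a b : ℕ, ((min (k + 1) b - a : ℕ) : ℝ) - ((min k b - a : ℕ) : ℝ) = if a ≤ k ∧ k < b then 1 else 0 := by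
    intro a b; split_ifs
    · rw [show min (k + 1) b - a = (min k b - a) + 1 by omega]; push_cast; ring
    · rw [show min (k + 1) b - a = min k b - a by omega]; ring
  rw [← h k₁ k₂, ← h k₂ (k₂ + M)]; ring

/-- The return ramp (`c = ℓ/M`) takes values in `[0, ℓ]`. [folklore] -/
theorem ramp_mem {k₁ k₂ M : ℕ} (hk : k₁ ≤ k₂) (hM : 1 ≤ M) (k : ℕ) :
    0 ≤ ((min k k₂ - k₁ : ℕ) : ℝ) - ((k₂ : ℝ) - k₁) / M * ((min k (k₂ + M) - k₂ : ℕ) : ℝ) ∧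
    ((min k k₂ - k₁ : ℕ) : ℝ) - ((k₂ : ℝ) - k₁) / M * ((min k (k₂ + M) - k₂ : ℕ) : ℝ) ≤ (k₂ : ℝ) - k₁ := by
  have hk' : (k₁ : ℝ) ≤ k₂ := by exact_mod_cast hk
  have hMr : (0 : ℝ) < M := by exact_mod_cast hM
  have hc : 0 ≤ ((k₂ : ℝ) - k₁) / M := div_nonneg (by linarith) hMr.le
  rcases le_total k k₂ with hkk | hkk
  · rw [show (min k (k₂ + M) - k₂ : ℕ) = 0 by omega, Nat.cast_zero, mul_zero, sub_zero, ← Nat.cast_sub hk]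
    exact ⟨Nat.cast_nonneg _, by exact_mod_cast (by omega : min k k₂ - k₁ ≤ k₂ - k₁)⟩
  · have hr : ((min k (k₂ + M) - k₂ : ℕ) : ℝ) ≤ M := by exact_mod_cast (by omega : (min k (k₂ + M) - k₂ : ℕ) ≤ M)
    have h3 := mul_le_mul_of_nonneg_left hr hc; rw [div_mul_cancel₀ _ hMr.ne'] at h3
    rw [show (min k k₂ - k₁ : ℕ) = k₂ - k₁ by omega, Nat.cast_sub hk]
    constructor <;> nlinarith [mul_nonneg hc (Nat.cast_nonneg (α := ℝ) (min k (k₂ + M) - k₂))]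

/-- The return ramp is supported in `(k₁, k₂ + M)`. [folklore] -/
theorem ramp_support {k₁ k₂ M : ℕ} (hk : k₁ ≤ k₂) (hM : 1 ≤ M) {k : ℕ}
    (h : ((min k k₂ - k₁ : ℕ) : ℝ) - ((k₂ : ℝ) - k₁) / M * ((min k (k₂ + M) - k₂ : ℕ) : ℝ) ≠ 0) :
    k₁ < k ∧ k < k₂ + M := by
  have hMr : (M : ℝ) ≠ 0 := by exact_mod_cast (by omega : M ≠ 0)
  by_contra hcon; rcases not_and_or.mp hcon with h1 | h1 <;> apply h
  · rw [show (min k k₂ - k₁ : ℕ) = 0 by omega, show (min k (k₂ + M) - k₂ : ℕ) = 0 by omega]; simp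
  · rw [show (min k k₂ - k₁ : ℕ) = k₂ - k₁ by omega, show (min k (k₂ + M) - k₂ : ℕ) = M by omega,
      Nat.cast_sub hk, div_mul_cancel₀ _ hMr]; ring

/-- `∑_{i<N} w_i² ≤ L² (b - a)` for weights bounded by `L` and supported in `(a, b)`. [folklore] -/
theorem sum_sq_le {N a b : ℕ} (hab : a ≤ b) {w : ℕ → ℝ} {L : ℝ} (hw : ∀ k, |w k| ≤ L)
    (hs : ∀ k, w k ≠ 0 → a < k ∧ k < b) : ∑ i : Fin N, (w i.val) ^ 2 ≤ L ^ 2 * ((b : ℝ) - a) := by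
  set S := (Finset.univ : Finset (Fin N)).filter (fun i => a ≤ i.val ∧ i.val < b) with hS
  have hcard : (S.card : ℝ) ≤ (b : ℝ) - a := by
    rw [← Nat.cast_sub hab, ← Nat.card_Ico a b]
    exact_mod_cast Finset.card_le_card_of_injOn (fun i : Fin N => i.val) (fun i hi => by
      simp only [hS, Finset.coe_filter, Finset.mem_univ, true_and, Set.mem_setOf_eq] at hi
      simpa [Finset.coe_Ico] using hi) Fin.val_injective.injOn
  calc ∑ i : Fin N, (w i.val) ^ 2 ≤ ∑ i : Fin N, L ^ 2 * (if a ≤ i.val ∧ i.val < b then 1 else 0) :=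
        Finset.sum_le_sum fun i _ => by
          split_ifs with h
          · rw [mul_one, ← sq_abs]; exact pow_le_pow_left₀ (abs_nonneg _) (hw _) 2
          · rw [show w i.val = 0 from not_not.mp fun hne => h ⟨(hs _ hne).1.le, (hs _ hne).2⟩]; simp
    _ = L ^ 2 * S.card := by rw [← Finset.mul_sum, Finset.sum_boole]
    _ ≤ _ := mul_le_mul_of_nonneg_left hcard (sq_nonneg _)

section Estimates

variable {ω₂ lam β : ℝ} {N : ℕ}

/-- `|W_w| ≤ L · H` when `|w_k| ≤ L` (every site and bond energy is nonnegative). [folklore] -/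
theorem abs_weightedEnergy_le (hω : 0 ≤ ω₂) (hl : 0 ≤ lam) (hβ : 0 ≤ β) (γ : ℝ) {w : ℕ → ℝ} {L : ℝ}
    (hw : ∀ k, |w k| ≤ L) (x : PhaseSpace N) :
    |weightedEnergy (pinnedChain ω₂ lam β γ) w N x| ≤ L * (pinnedChain ω₂ lam β γ).hamiltonian N x := by
  -- adapted from Cruxes/SubBallisticWindow/Disproof.lean (`blockEnergy_nonneg_le`)
  have ha : ∀ k : Fin N, 0 ≤ x.2 k ^ 2 / 2 + (pinnedChain ω₂ lam β γ).U (x.1 k) := fun k => by simp only [pinnedChain]; positivity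
  have hb : ∀ k l : Fin N, 0 ≤ (pinnedChain ω₂ lam β γ).V (x.1 l - x.1 k) := fun k l => by simp only [pinnedChain]; positivity
  unfold weightedEnergy OscillatorChain.hamiltonian
  rw [mul_add, Finset.mul_sum, Finset.mul_sum]
  refine (abs_add_le _ _).trans (add_le_add ?_ ?_) <;>
    refine (Finset.abs_sum_le_sum_abs _ _).trans (Finset.sum_le_sum fun k _ => ?_)
  · rw [abs_mul, abs_of_nonneg (ha k)]; exact mul_le_mul_of_nonneg_right (hw _) (ha k)
  · rw [Finset.mul_sum]
    refine (Finset.abs_sum_le_sum_abs _ _).trans (Finset.sum_le_sum fun l _ => ?_)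
    split_ifs
    · rw [abs_mul, abs_of_nonneg (hb k l), abs_div, abs_two]
      exact mul_le_mul_of_nonneg_right (by linarith [abs_add_le (w k.val) (w l.val), hw k.val, hw l.val]) (hb k l)
    · simp

/-- The bond part of `∂_{q_i} W_w`: only the bonds `(i-1,i)` and `(i,i+1)` contribute. [folklore] -/
theorem bondGrad_eq (P : OscillatorChain) (w : ℕ → ℝ) (i : Fin N) (q : Fin N → ℝ) :
    (∑ k : Fin N, ∑ l : Fin N, if l.val = k.val + 1 then
      ((w k.val + w l.val) / 2) * deriv P.V (q l - q k) * ((if l = i then 1 else 0) - (if k = i then 1 else 0)) else 0) =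
    (∑ k : Fin N, if i.val = k.val + 1 then ((w k.val + w i.val) / 2) * deriv P.V (q i - q k) else 0) -
      ∑ l : Fin N, if l.val = i.val + 1 then ((w i.val + w l.val) / 2) * deriv P.V (q l - q i) else 0 := by
  have hsplit : ∀ k l : Fin N, (if l.val = k.val + 1 then
      ((w k.val + w l.val) / 2) * deriv P.V (q l - q k) * ((if l = i then 1 else 0) - (if k = i then 1 else 0)) else 0) =
      (if l = i then (if l.val = k.val + 1 then ((w k.val + w l.val) / 2) * deriv P.V (q l - q k) else 0) else 0) -
      (if k = i then (if l.val = k.val + 1 then ((w k.val + w l.val) / 2) * deriv P.V (q l - q k) else 0) else 0) := by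
    intro k l; split_ifs <;> ring
  simp_rw [hsplit, Finset.sum_sub_distrib, Finset.sum_ite_eq', Finset.mem_univ, if_true,
    Finset.sum_ite_irrel, Finset.sum_const_zero, Finset.sum_ite_eq', Finset.mem_univ, if_true]

/-- `(∑_k 1_{p k} F_k)² ≤ ∑_k 1_{p k} F_k²` when `p` holds for at most one index. [folklore] -/
theorem sq_sum_ite_le {p : Fin N → Prop} [DecidablePred p] (hp : ∀ a b, p a → p b → a = b) (F : Fin N → ℝ) :
    (∑ k : Fin N, if p k then F k else 0) ^ 2 ≤ ∑ k : Fin N, if p k then (F k) ^ 2 else 0 := by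
  rw [← Finset.sum_filter, ← Finset.sum_filter]
  have hcard : (((Finset.univ : Finset (Fin N)).filter p).card : ℝ) ≤ 1 := by
    exact_mod_cast Finset.card_le_one.mpr fun a ha b hb => hp a b (Finset.mem_filter.mp ha).2 (Finset.mem_filter.mp hb).2
  calc _ ≤ _ := sq_sum_le_card_mul_sum_sq
    _ ≤ 1 * _ := mul_le_mul_of_nonneg_right hcard (Finset.sum_nonneg fun _ _ => sq_nonneg _)
    _ = _ := one_mul _

/-- **Pointwise gradient bound**: `|∇W_w|²` is dominated by the site polynomials `m_i = q_i² + q_i⁶ + p_i²`, weighted by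
`w_i²` and, on the bonds `l = k+1`, by `w_l² + w_k²`. [folklore] -/
theorem gradSq_le (γ : ℝ) (w : ℕ → ℝ) (x : PhaseSpace N) :
    ∑ i : Fin N, ((dWeightedEnergy (pinnedChain ω₂ lam β γ) w N i x.1) ^ 2 + (w i.val * x.2 i) ^ 2) ≤
      (6 * ω₂ ^ 2 + 6 * lam ^ 2 + 1) * ∑ i : Fin N, (w i.val) ^ 2 * (x.1 i ^ 2 + x.1 i ^ 6 + x.2 i ^ 2) +
      (12 + 192 * β ^ 2) * ∑ k : Fin N, ∑ l : Fin N, (if l.val = k.val + 1 then (w l.val) ^ 2 + (w k.val) ^ 2 else 0) *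
        ((x.1 k ^ 2 + x.1 k ^ 6 + x.2 k ^ 2) + (x.1 l ^ 2 + x.1 l ^ 6 + x.2 l ^ 2)) := by
  set q := x.1 with hq; set p := x.2 with hp
  set F : Fin N → Fin N → ℝ := fun k l => ((w k.val + w l.val) / 2) * deriv (pinnedChain ω₂ lam β γ).V (q l - q k) with hF
  have key : ∀ i : Fin N, (dWeightedEnergy (pinnedChain ω₂ lam β γ) w N i q) ^ 2 + (w i.val * p i) ^ 2 ≤
      (6 * ω₂ ^ 2 + 6 * lam ^ 2 + 1) * ((w i.val) ^ 2 * (q i ^ 2 + q i ^ 6 + p i ^ 2)) +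
      3 * (∑ k : Fin N, if i.val = k.val + 1 then (F k i) ^ 2 else 0) +
      3 * (∑ l : Fin N, if l.val = i.val + 1 then (F i l) ^ 2 else 0) := by
    intro i
    unfold dWeightedEnergy
    rw [bondGrad_eq, pinnedChain_deriv_U]
    set b := ∑ k : Fin N, if i.val = k.val + 1 then F k i else 0
    set c := ∑ l : Fin N, if l.val = i.val + 1 then F i l else 0
    have hb : b ^ 2 ≤ ∑ k : Fin N, if i.val = k.val + 1 then (F k i) ^ 2 else 0 :=
      sq_sum_ite_le (p := fun k : Fin N => i.val = k.val + 1) (fun k k' hk hk' => Fin.ext (by omega)) fun k => F k i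
    have hc : c ^ 2 ≤ ∑ l : Fin N, if l.val = i.val + 1 then (F i l) ^ 2 else 0 :=
      sq_sum_ite_le (p := fun l : Fin N => l.val = i.val + 1) (fun l l' hl hl' => Fin.ext (by omega)) fun l => F i l
    set a := ω₂ * q i + lam * q i ^ 3
    have ha : a ^ 2 ≤ 2 * ω₂ ^ 2 * q i ^ 2 + 2 * lam ^ 2 * q i ^ 6 := by nlinarith [sq_nonneg (ω₂ * q i - lam * q i ^ 3)]
    have hm : 0 ≤ 6 * ω₂ ^ 2 * (q i ^ 6 + p i ^ 2) + 6 * lam ^ 2 * (q i ^ 2 + p i ^ 2) + (q i ^ 2 + q i ^ 6) := by positivity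
    have h3 : (w i.val * a + (b - c)) ^ 2 ≤ 3 * (w i.val * a) ^ 2 + 3 * b ^ 2 + 3 * c ^ 2 := by
      nlinarith [sq_nonneg (w i.val * a - b), sq_nonneg (w i.val * a + c), sq_nonneg (b + c)]
    nlinarith [mul_le_mul_of_nonneg_left ha (sq_nonneg (w i.val)), mul_nonneg (sq_nonneg (w i.val)) hm]
  have hV : ∀ k l : Fin N, 6 * (F k l) ^ 2 ≤ (12 + 192 * β ^ 2) *
      (((w l.val) ^ 2 + (w k.val) ^ 2) * ((q k ^ 2 + q k ^ 6 + p k ^ 2) + (q l ^ 2 + q l ^ 6 + p l ^ 2))) := by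
    intro k l
    have h1 : (F k l) ^ 2 ≤ (((w l.val) ^ 2 + (w k.val) ^ 2) / 2) *
        ((4 + 64 * β ^ 2) * ((q k ^ 2 + q k ^ 6 + p k ^ 2) + (q l ^ 2 + q l ^ 6 + p l ^ 2))) := by
      simp only [hF, mul_pow, pinnedChain_deriv_V]
      refine mul_le_mul (by nlinarith [sq_nonneg (w k.val - w l.val)]) ?_ (sq_nonneg _) (by positivity)
      have h2 : (q l - q k) ^ 2 ≤ 2 * q l ^ 2 + 2 * q k ^ 2 := by nlinarith [sq_nonneg (q k + q l)]
      have h3 := mul_le_mul_of_nonneg_left (sub_pow_six_le (q k) (q l)) (sq_nonneg β)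
      have h4 : (q l - q k + β * (q l - q k) ^ 3) ^ 2 ≤ 2 * (q l - q k) ^ 2 + 2 * (β ^ 2 * (q l - q k) ^ 6) := by
        nlinarith [sq_nonneg (q l - q k - β * (q l - q k) ^ 3)]
      have h5 : 0 ≤ 4 * (q k ^ 6 + p k ^ 2 + q l ^ 6 + p l ^ 2) + 64 * β ^ 2 * (q k ^ 2 + p k ^ 2 + q l ^ 2 + p l ^ 2) := by positivity
      nlinarith [h2, h3, h4, h5]
    nlinarith [h1]
  have hS : ∑ i : Fin N, (∑ k : Fin N, if i.val = k.val + 1 then (F k i) ^ 2 else 0) =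
      ∑ k : Fin N, ∑ l : Fin N, if l.val = k.val + 1 then (F k l) ^ 2 else 0 := Finset.sum_comm
  have hB : 6 * (∑ k : Fin N, ∑ l : Fin N, if l.val = k.val + 1 then (F k l) ^ 2 else 0) ≤
      (12 + 192 * β ^ 2) * ∑ k : Fin N, ∑ l : Fin N, (if l.val = k.val + 1 then (w l.val) ^ 2 + (w k.val) ^ 2 else 0) *
        ((q k ^ 2 + q k ^ 6 + p k ^ 2) + (q l ^ 2 + q l ^ 6 + p l ^ 2)) := by
    simp_rw [Finset.mul_sum]
    exact Finset.sum_le_sum fun k _ => Finset.sum_le_sum fun l _ => by split_ifs; exacts [hV k l, by simp]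
  calc ∑ i : Fin N, ((dWeightedEnergy (pinnedChain ω₂ lam β γ) w N i q) ^ 2 + (w i.val * p i) ^ 2)
      ≤ ∑ i : Fin N, ((6 * ω₂ ^ 2 + 6 * lam ^ 2 + 1) * ((w i.val) ^ 2 * (q i ^ 2 + q i ^ 6 + p i ^ 2)) +
          3 * (∑ k : Fin N, if i.val = k.val + 1 then (F k i) ^ 2 else 0) +
          3 * (∑ l : Fin N, if l.val = i.val + 1 then (F i l) ^ 2 else 0)) := Finset.sum_le_sum fun i _ => key i
    _ = (6 * ω₂ ^ 2 + 6 * lam ^ 2 + 1) * ∑ i : Fin N, (w i.val) ^ 2 * (q i ^ 2 + q i ^ 6 + p i ^ 2) +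
          (3 * (∑ i : Fin N, ∑ k : Fin N, if i.val = k.val + 1 then (F k i) ^ 2 else 0) +
           3 * (∑ k : Fin N, ∑ l : Fin N, if l.val = k.val + 1 then (F k l) ^ 2 else 0)) := by
        rw [Finset.sum_add_distrib, Finset.sum_add_distrib, ← Finset.mul_sum, ← Finset.mul_sum, ← Finset.mul_sum, add_assoc]
    _ ≤ _ := by rw [hS]; linarith [hB]

variable (hω : 0 < ω₂) (hl : 0 ≤ lam) (hβ : 0 ≤ β) (γ : ℝ) {T : ℝ} (hT : 0 < T)
include hω hl hβ hT

/-- The site monomials `q_i², q_i⁶, p_i²` are integrable against the Gibbs weight. [folklore] -/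
theorem integrable_monomials (i : Fin N) :
    Integrable (fun x : PhaseSpace N => x.1 i ^ 2) (gibbsWeight ω₂ lam β γ N T) ∧
    Integrable (fun x : PhaseSpace N => x.1 i ^ 6) (gibbsWeight ω₂ lam β γ N T) ∧
    Integrable (fun x : PhaseSpace N => x.2 i ^ 2) (gibbsWeight ω₂ lam β γ N T) := by
  have hH0 := fun x => pinnedChain_hamiltonian_nonneg hω.le hl hβ γ N x
  have hq2 : ∀ x : PhaseSpace N, x.1 i ^ 2 ≤ 2 / ω₂ * (1 + (pinnedChain ω₂ lam β γ).hamiltonian N x) := fun x => by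
    have h := pinnedChain_U_le_hamiltonian hω.le hl hβ γ N x i
    rw [div_mul_eq_mul_div, le_div_iff₀ hω]
    nlinarith [mul_nonneg hl (by positivity : (0:ℝ) ≤ x.1 i ^ 4), hH0 x]
  have hI := fun (f : PhaseSpace N → ℝ) (hf : Continuous f) =>
    integrable_of_abs_le_pow hω hl hβ γ N hT hf.aestronglyMeasurable
  refine ⟨hI _ (by fun_prop) (2 / ω₂) 1 fun x => ?_, hI _ (by fun_prop) ((2 / ω₂) ^ 3) 3 fun x => ?_,
    hI _ (by fun_prop) 4 2 fun x => pinnedChain_abs_momentum_pow_le hω.le hl hβ γ N x i (by norm_num)⟩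
  · rw [abs_of_nonneg (sq_nonneg _), pow_one]; exact hq2 x
  · rw [abs_of_nonneg (by positivity), ← mul_pow, show x.1 i ^ 6 = (x.1 i ^ 2) ^ 3 by ring]
    exact pow_le_pow_left₀ (sq_nonneg _) (hq2 x) 3

/-- Block currents are in `L²(μ)`. [folklore] -/
theorem memLp_blockCurrent (k₁ k₂ : ℕ) : MemLp (blockCurrent ω₂ lam β γ N k₁ k₂) 2 (gibbsWeight ω₂ lam β γ N T) :=
  memLp_two_of_abs_le_pow hω hl hβ γ N hT (continuous_blockCurrent N γ k₁ k₂).aestronglyMeasurable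
    (N * (N * ((3 + β) / 2))) 2 fun x => (abs_blockCurrent_le N γ k₁ k₂ x).trans <| by
      calc ∑ i : Fin N, |(pinnedChain ω₂ lam β γ).bondCurrent N i x|
          ≤ ∑ _i : Fin N, N * ((3 + β) / 2 * (1 + (pinnedChain ω₂ lam β γ).hamiltonian N x) ^ 2) :=
            Finset.sum_le_sum fun i _ => pinnedChain_abs_bondCurrent_le hω.le hl hβ γ N i x
        _ = _ := by simp only [Finset.sum_const, Finset.card_univ, Fintype.card_fin, nsmul_eq_mul]; ring

/-- **Dirichlet-form bound**: for weights bounded by `L` and supported in `(a,b)`, `|∇W_w|² ∈ L¹(μ)` and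
`∫ |∇W_w|² dμ ≤ C_W D L² (b - a) Z` (`D Z` a common bound of the per-site moments `∫ q_i², ∫ q_i⁶, ∫ p_i²`). [folklore] -/
theorem gradient_bound {w : ℕ → ℝ} {L : ℝ} {a b : ℕ} (hab : a ≤ b) (hw : ∀ k, |w k| ≤ L)
    (hs : ∀ k, w k ≠ 0 → a < k ∧ k < b) {D Z : ℝ} (hD : 0 ≤ D) (hZ : 0 ≤ Z)
    (hmo : ∀ i : Fin N, ∫ x, x.1 i ^ 2 ∂(gibbsWeight ω₂ lam β γ N T) ≤ D * Z ∧
      ∫ x, x.1 i ^ 6 ∂(gibbsWeight ω₂ lam β γ N T) ≤ D * Z ∧ ∫ x, x.2 i ^ 2 ∂(gibbsWeight ω₂ lam β γ N T) ≤ D * Z) :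
    Integrable (fun x => ∑ i : Fin N, ((partialQ i (weightedEnergy (pinnedChain ω₂ lam β γ) w N) x) ^ 2 +
        (partialP i (weightedEnergy (pinnedChain ω₂ lam β γ) w N) x) ^ 2)) (gibbsWeight ω₂ lam β γ N T) ∧
    ∫ x, (∑ i : Fin N, ((partialQ i (weightedEnergy (pinnedChain ω₂ lam β γ) w N) x) ^ 2 +
        (partialP i (weightedEnergy (pinnedChain ω₂ lam β γ) w N) x) ^ 2)) ∂(gibbsWeight ω₂ lam β γ N T) ≤
      ((6 * ω₂ ^ 2 + 6 * lam ^ 2 + 1) + 4 * (12 + 192 * β ^ 2)) * (3 * D) * (L ^ 2 * ((b : ℝ) - a)) * Z := by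
  set μ := gibbsWeight ω₂ lam β γ N T
  set G := weightedEnergy (pinnedChain ω₂ lam β γ) w N with hG
  set g : PhaseSpace N → ℝ := fun x => ∑ i : Fin N, ((partialQ i G x) ^ 2 + (partialP i G x) ^ 2) with hg
  set m : Fin N → PhaseSpace N → ℝ := fun i x => x.1 i ^ 2 + x.1 i ^ 6 + x.2 i ^ 2 with hm
  set KA : ℝ := 6 * ω₂ ^ 2 + 6 * lam ^ 2 + 1
  set KB : ℝ := 12 + 192 * β ^ 2
  have hG2 : ContDiff ℝ 2 G := contDiff_weightedEnergy _ (pinnedChain_contDiff_U ω₂ lam β γ) (pinnedChain_contDiff_V ω₂ lam β γ) w N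
  have hmI : ∀ i, Integrable (m i) μ ∧ ∫ x, m i x ∂μ ≤ 3 * D * Z := fun i => by
    obtain ⟨h2, h6, hp⟩ := integrable_monomials hω hl hβ γ hT i
    refine ⟨(h2.fun_add h6).fun_add hp, ?_⟩
    simp only [hm]; rw [integral_add (h2.fun_add h6) hp, integral_add h2 h6]
    linarith [(hmo i).1, (hmo i).2.1, (hmo i).2.2]
  have hR1 : Integrable (fun x => ∑ i : Fin N, (w i.val) ^ 2 * m i x) μ := integrable_finsetSum _ fun i _ => (hmI i).1.const_mul _
  have hR2 : Integrable (fun x => ∑ k : Fin N, ∑ l : Fin N,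
      (if l.val = k.val + 1 then (w l.val) ^ 2 + (w k.val) ^ 2 else 0) * (m k x + m l x)) μ :=
    integrable_finsetSum _ fun k _ => integrable_finsetSum _ fun l _ => ((hmI k).1.fun_add (hmI l).1).const_mul _
  have hpt : ∀ x, g x ≤ KA * (∑ i : Fin N, (w i.val) ^ 2 * m i x) +
      KB * ∑ k : Fin N, ∑ l : Fin N, (if l.val = k.val + 1 then (w l.val) ^ 2 + (w k.val) ^ 2 else 0) * (m k x + m l x) := by
    intro x
    simp only [hg, hG, hm, partialQ_weightedEnergy _ ((pinnedChain_contDiff_U ω₂ lam β γ (n := 1)).differentiable one_ne_zero)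
      ((pinnedChain_contDiff_V ω₂ lam β γ (n := 1)).differentiable one_ne_zero), partialP_weightedEnergy]
    exact gradSq_le γ w x
  have hRint := (hR1.const_mul KA).fun_add (hR2.const_mul KB)
  have hint : Integrable g μ := hRint.mono'
    (continuous_finsetSum _ fun i _ => ((continuous_partialQ hG2 two_ne_zero i).pow 2).add
      ((continuous_partialP hG2 two_ne_zero i).pow 2)).aestronglyMeasurable
    (Eventually.of_forall fun x => by
      rw [Real.norm_eq_abs, abs_of_nonneg (Finset.sum_nonneg fun i _ => by positivity)]; exact hpt x)
  refine ⟨hint, (integral_mono hint hRint hpt).trans ?_⟩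
  rw [integral_add (hR1.const_mul KA) (hR2.const_mul KB), integral_const_mul, integral_const_mul,
    integral_finsetSum _ fun i _ => (hmI i).1.const_mul _,
    integral_finsetSum _ fun k _ => integrable_finsetSum _ fun l _ => ((hmI k).1.fun_add (hmI l).1).const_mul _]
  have I1 : ∑ i : Fin N, ∫ x, (w i.val) ^ 2 * m i x ∂μ ≤ (L ^ 2 * ((b : ℝ) - a)) * (3 * D * Z) :=
    calc ∑ i : Fin N, ∫ x, (w i.val) ^ 2 * m i x ∂μ ≤ ∑ i : Fin N, (w i.val) ^ 2 * (3 * D * Z) :=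
          Finset.sum_le_sum fun i _ => by
            rw [integral_const_mul]; exact mul_le_mul_of_nonneg_left (hmI i).2 (sq_nonneg _)
      _ ≤ _ := by rw [← Finset.sum_mul]; exact mul_le_mul_of_nonneg_right (sum_sq_le hab hw hs) (by positivity)
  have I2 : ∑ k : Fin N, ∫ x, ∑ l : Fin N, (if l.val = k.val + 1 then (w l.val) ^ 2 + (w k.val) ^ 2 else 0) *
      (m k x + m l x) ∂μ ≤ (2 * (L ^ 2 * ((b : ℝ) - a))) * (2 * (3 * D * Z)) :=
    calc _ ≤ ∑ k : Fin N, ∑ l : Fin N, (if l.val = k.val + 1 then (w l.val) ^ 2 + (w k.val) ^ 2 else 0) *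
          (2 * (3 * D * Z)) := by
          refine Finset.sum_le_sum fun k _ => ?_
          rw [integral_finsetSum _ fun l _ => ((hmI k).1.fun_add (hmI l).1).const_mul _]
          refine Finset.sum_le_sum fun l _ => ?_
          rw [integral_const_mul, integral_add (hmI k).1 (hmI l).1]
          exact mul_le_mul_of_nonneg_left (by linarith [(hmI k).2, (hmI l).2]) (by split_ifs <;> positivity)
      _ = (∑ k : Fin N, ∑ l : Fin N, (if l.val = k.val + 1 then (w l.val) ^ 2 + (w k.val) ^ 2 else 0)) *
          (2 * (3 * D * Z)) := by
          rw [Finset.sum_mul]; exact Finset.sum_congr rfl fun k _ => (Finset.sum_mul _ _ _).symm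
      _ ≤ _ := mul_le_mul_of_nonneg_right ((sum_bond_ends_le N (f := fun i : Fin N => (w i.val) ^ 2)
          fun i => sq_nonneg _).trans (mul_le_mul_of_nonneg_left (sum_sq_le hab hw hs) (by norm_num))) (by positivity)
  nlinarith [mul_le_mul_of_nonneg_left I1 (by positivity : (0 : ℝ) ≤ KA), mul_le_mul_of_nonneg_left I2 (by positivity : (0 : ℝ) ≤ KB)]

end Estimates

/-- The Poisson bracket of `H` with the return-ramp energy is a difference of block currents:
`{H, W_w} = J_{[k₁,k₂)} - c · J_{[k₂,k₂+M)}` for `w_k = (min(k,k₂) ∸ k₁) - c (min(k,k₂+M) ∸ k₂)`. [folklore] -/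
theorem poisson_weightedEnergy_ramp (ω₂ lam β γ : ℝ) (N k₁ k₂ M : ℕ) (c : ℝ) (x : PhaseSpace N) :
    poisson ((pinnedChain ω₂ lam β γ).hamiltonian N) (weightedEnergy (pinnedChain ω₂ lam β γ)
      (fun k => ((min k k₂ - k₁ : ℕ) : ℝ) - c * ((min k (k₂ + M) - k₂ : ℕ) : ℝ)) N) x =
    blockCurrent ω₂ lam β γ N k₁ k₂ x - c * blockCurrent ω₂ lam β γ N k₂ (k₂ + M) x := by
  unfold blockCurrent
  rw [poisson_hamiltonian_weightedEnergy _ ((pinnedChain_contDiff_U ω₂ lam β γ (n := 1)).differentiable one_ne_zero)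
    ((pinnedChain_contDiff_V ω₂ lam β γ (n := 1)).differentiable one_ne_zero), Finset.mul_sum, ← Finset.sum_sub_distrib]
  refine Finset.sum_congr rfl fun i _ => ?_
  rw [ramp_grad k₁ k₂ M c i.val]
  split_ifs <;> ring

/-- **`stub_rampCorrector`** (stub of line `Sketch`, crux `SubBallisticWindow`): from the Poincaré inequality, the `N`-uniform
coordinate moments and the `N`-uniform static block-current bound there is `C` such that for every `N`, block `[k₁,k₂)` and
`τ ≥ 1` the RETURN-RAMP energy `G = W_w`, `c = (∫ G dμ)/Z` give `8 ∫ (G-c)² dμ + 2τ² ∫ (J_B - {H,G})² dμ ≤ C ℓ²(ℓ+τ) Z`. [folklore] -/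
theorem stub_rampCorrector :
    ∀ ω₂ lam β γ : ℝ, 0 < ω₂ → 0 ≤ lam → 0 ≤ β → ∀ T : ℝ, 0 < T →
      (∀ (N : ℕ) (G : PhaseSpace N → ℝ),
      ContDiff ℝ 1 G →
      MemLp G 2 (volume.withDensity fun x : PhaseSpace N => ENNReal.ofReal (Real.exp (-((pinnedChain ω₂ lam β γ).hamiltonian N x) / T))) →
      Integrable (fun x : PhaseSpace N => ∑ i : Fin N, ((partialQ i G x) ^ 2 + (partialP i G x) ^ 2))
        (volume.withDensity fun x : PhaseSpace N => ENNReal.ofReal (Real.exp (-((pinnedChain ω₂ lam β γ).hamiltonian N x) / T))) →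
      ∫ x, (G x - (∫ y, G y ∂(volume.withDensity fun x : PhaseSpace N => ENNReal.ofReal (Real.exp (-((pinnedChain ω₂ lam β γ).hamiltonian N x) / T)))) /
          (∫ x : PhaseSpace N, Real.exp (-((pinnedChain ω₂ lam β γ).hamiltonian N x) / T))) ^ 2
        ∂(volume.withDensity fun x : PhaseSpace N => ENNReal.ofReal (Real.exp (-((pinnedChain ω₂ lam β γ).hamiltonian N x) / T))) ≤
        T / min ω₂ 1 * ∫ x, (∑ i : Fin N, ((partialQ i G x) ^ 2 + (partialP i G x) ^ 2))
          ∂(volume.withDensity fun x : PhaseSpace N => ENNReal.ofReal (Real.exp (-((pinnedChain ω₂ lam β γ).hamiltonian N x) / T)))) →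
      (∀ m : ℕ, ∃ C : ℝ, ∀ (N : ℕ) (i : Fin N),
        ∫ x, (x.1 i) ^ (2 * m) ∂(volume.withDensity fun x : PhaseSpace N => ENNReal.ofReal (Real.exp (-((pinnedChain ω₂ lam β γ).hamiltonian N x) / T)))
            ≤ C * (∫ x : PhaseSpace N, Real.exp (-((pinnedChain ω₂ lam β γ).hamiltonian N x) / T)) ∧
        ∫ x, (x.2 i) ^ (2 * m) ∂(volume.withDensity fun x : PhaseSpace N => ENNReal.ofReal (Real.exp (-((pinnedChain ω₂ lam β γ).hamiltonian N x) / T)))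
            ≤ C * (∫ x : PhaseSpace N, Real.exp (-((pinnedChain ω₂ lam β γ).hamiltonian N x) / T))) →
      (∃ C : ℝ, ∀ (N k₁ k₂ : ℕ), k₁ ≤ k₂ →
        ∫ x, ((fun z : PhaseSpace N => ∑ i : Fin N, (if k₁ ≤ i.val ∧ i.val < k₂ then (pinnedChain ω₂ lam β γ).bondCurrent N i z else 0)) x) ^ 2
          ∂(volume.withDensity fun x : PhaseSpace N => ENNReal.ofReal (Real.exp (-((pinnedChain ω₂ lam β γ).hamiltonian N x) / T))) ≤
          C * ((k₂ : ℝ) - k₁) * (∫ x : PhaseSpace N, Real.exp (-((pinnedChain ω₂ lam β γ).hamiltonian N x) / T))) →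
      ∃ C : ℝ,
      ∀ (N k₁ k₂ : ℕ), k₁ ≤ k₂ → k₂ + 1 ≤ N → ∀ τ : ℝ, 1 ≤ τ →
        ∃ (G : PhaseSpace N → ℝ) (c : ℝ), ContDiff ℝ 2 G ∧
          MemLp G 2 (volume.withDensity fun x : PhaseSpace N => ENNReal.ofReal (Real.exp (-((pinnedChain ω₂ lam β γ).hamiltonian N x) / T))) ∧
          MemLp (poisson ((pinnedChain ω₂ lam β γ).hamiltonian N) G) 2
            (volume.withDensity fun x : PhaseSpace N => ENNReal.ofReal (Real.exp (-((pinnedChain ω₂ lam β γ).hamiltonian N x) / T))) ∧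
          8 * ∫ x, (G x - c) ^ 2
              ∂(volume.withDensity fun x : PhaseSpace N => ENNReal.ofReal (Real.exp (-((pinnedChain ω₂ lam β γ).hamiltonian N x) / T))) +
            2 * τ ^ 2 * ∫ x,
              ((fun z : PhaseSpace N => ∑ i : Fin N, (if k₁ ≤ i.val ∧ i.val < k₂ then (pinnedChain ω₂ lam β γ).bondCurrent N i z else 0)) x
                - poisson ((pinnedChain ω₂ lam β γ).hamiltonian N) G x) ^ 2
              ∂(volume.withDensity fun x : PhaseSpace N => ENNReal.ofReal (Real.exp (-((pinnedChain ω₂ lam β γ).hamiltonian N x) / T))) ≤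
            C * ((k₂ : ℝ) - k₁) ^ 2 * (((k₂ : ℝ) - k₁) + τ) * (∫ x : PhaseSpace N, Real.exp (-((pinnedChain ω₂ lam β γ).hamiltonian N x) / T)) := by
  intro ω₂ lam β γ hω hl hβ T hT hP hM hJ
  obtain ⟨⟨C₁, hC₁⟩, ⟨C₃, hC₃⟩, ⟨CJ, hCJ⟩⟩ := And.intro (hM 1) (And.intro (hM 3) hJ)
  simp only [mul_one] at hC₁; simp only [Nat.reduceMul] at hC₃
  set D := max (max C₁ C₃) 0 with hD
  set DJ := max CJ 0 with hDJ
  have hD0 : 0 ≤ D := le_max_right _ _; have hDJ0 : 0 ≤ DJ := le_max_right _ _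
  have hK0 : 0 ≤ T / min ω₂ 1 := div_nonneg hT.le (le_min hω.le zero_le_one)
  set CE : ℝ := ((6 * ω₂ ^ 2 + 6 * lam ^ 2 + 1) + 4 * (12 + 192 * β ^ 2)) * (3 * D) with hCE
  refine ⟨8 * (T / min ω₂ 1) * CE + 4 * DJ, fun N k₁ k₂ hk hN τ hτ => ?_⟩
  set μ : Measure (PhaseSpace N) := volume.withDensity fun x : PhaseSpace N =>
    ENNReal.ofReal (Real.exp (-((pinnedChain ω₂ lam β γ).hamiltonian N x) / T)) with hμ
  set Z : ℝ := ∫ x : PhaseSpace N, Real.exp (-((pinnedChain ω₂ lam β γ).hamiltonian N x) / T) with hZ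
  have hZ0 : 0 ≤ Z := integral_nonneg fun x => (Real.exp_pos _).le
  set M := ⌊τ⌋₊ with hM_def
  have hM1 : 1 ≤ M := (Nat.one_le_floor_iff τ).mpr hτ; have hMpos : (0 : ℝ) < M := by exact_mod_cast hM1
  have hMτ : (M : ℝ) ≤ τ := Nat.floor_le (by linarith only [hτ]); have hτM : τ < M + 1 := Nat.lt_floor_add_one τ
  set L : ℝ := (k₂ : ℝ) - k₁ with hL; have hL0 : 0 ≤ L := sub_nonneg.mpr (by exact_mod_cast hk)
  set w : ℕ → ℝ := fun k => ((min k k₂ - k₁ : ℕ) : ℝ) - L / M * ((min k (k₂ + M) - k₂ : ℕ) : ℝ) with hw_def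
  have hw : ∀ k, |w k| ≤ L := fun k => (abs_of_nonneg (ramp_mem hk hM1 k).1).trans_le (ramp_mem hk hM1 k).2
  have hs : ∀ k, w k ≠ 0 → k₁ < k ∧ k < k₂ + M := fun k h => ramp_support hk hM1 h
  have hmo : ∀ i : Fin N, ∫ x, x.1 i ^ 2 ∂μ ≤ D * Z ∧ ∫ x, x.1 i ^ 6 ∂μ ≤ D * Z ∧ ∫ x, x.2 i ^ 2 ∂μ ≤ D * Z :=
    fun i => ⟨(hC₁ N i).1.trans (mul_le_mul_of_nonneg_right (le_max_of_le_left (le_max_left _ _)) hZ0),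
      (hC₃ N i).1.trans (mul_le_mul_of_nonneg_right (le_max_of_le_left (le_max_right _ _)) hZ0),
      (hC₁ N i).2.trans (mul_le_mul_of_nonneg_right (le_max_of_le_left (le_max_left _ _)) hZ0)⟩
  obtain ⟨hInt, hgrad⟩ := gradient_bound hω hl hβ γ hT (show k₁ ≤ k₂ + M by omega) hw hs hD0 hZ0 hmo
  set G := weightedEnergy (pinnedChain ω₂ lam β γ) w N with hG
  have hG2 : ContDiff ℝ 2 G := contDiff_weightedEnergy _ (pinnedChain_contDiff_U ω₂ lam β γ) (pinnedChain_contDiff_V ω₂ lam β γ) w N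
  have hGL2 : MemLp G 2 μ := memLp_two_of_abs_le_pow hω hl hβ γ N hT hG2.continuous.aestronglyMeasurable L 1 fun x => by
    have h := abs_weightedEnergy_le hω.le hl hβ γ hw x
    nlinarith [pinnedChain_hamiltonian_nonneg hω.le hl hβ γ N x, hL0]
  have hPo : poisson ((pinnedChain ω₂ lam β γ).hamiltonian N) G =
      fun x => blockCurrent ω₂ lam β γ N k₁ k₂ x - L / M * blockCurrent ω₂ lam β γ N k₂ (k₂ + M) x :=
    funext fun x => poisson_weightedEnergy_ramp ω₂ lam β γ N k₁ k₂ M (L / M) x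
  have hPL2 : MemLp (poisson ((pinnedChain ω₂ lam β γ).hamiltonian N) G) 2 μ := by
    rw [hPo]; exact (memLp_blockCurrent hω hl hβ γ hT k₁ k₂).sub ((memLp_blockCurrent hω hl hβ γ hT k₂ (k₂ + M)).const_mul _)
  refine ⟨G, (∫ y, G y ∂μ) / Z, hG2, hGL2, hPL2, ?_⟩
  -- variance: Poincaré + Dirichlet-form bound, `L + M ≤ L + τ`
  have hvar : 8 * ∫ x, (G x - (∫ y, G y ∂μ) / Z) ^ 2 ∂μ ≤ 8 * (T / min ω₂ 1) * CE * (L ^ 2 * (L + τ)) * Z := by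
    rw [show ((k₂ + M : ℕ) : ℝ) - k₁ = L + M by rw [hL]; push_cast; ring] at hgrad
    have h1 : CE * (L ^ 2 * (L + M)) * Z ≤ CE * (L ^ 2 * (L + τ)) * Z := by gcongr
    have h2 := mul_le_mul_of_nonneg_left ((hP N G (hG2.of_le (by norm_num)) hGL2 hInt).trans
      (mul_le_mul_of_nonneg_left (hgrad.trans h1) hK0)) (by norm_num : (0 : ℝ) ≤ 8)
    exact h2.trans_eq (by ring)
  -- defect: `J_B - {H,G} = (L/M) J_{[k₂,k₂+M)}`, the static current bound and `τ²/M ≤ 2τ`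
  have hdefect : 2 * τ ^ 2 * ∫ x, (blockCurrent ω₂ lam β γ N k₁ k₂ x -
      poisson ((pinnedChain ω₂ lam β γ).hamiltonian N) G x) ^ 2 ∂μ ≤ 4 * DJ * (L ^ 2 * (L + τ)) * Z := by
    have hJ2 : ∫ x, (blockCurrent ω₂ lam β γ N k₂ (k₂ + M) x) ^ 2 ∂μ ≤ DJ * M * Z := by
      have h := hCJ N k₂ (k₂ + M) (Nat.le_add_right _ _)
      rw [show ((k₂ + M : ℕ) : ℝ) - k₂ = M by push_cast; ring] at h
      exact h.trans (mul_le_mul_of_nonneg_right (mul_le_mul_of_nonneg_right (le_max_left _ _) hMpos.le) hZ0)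
    have e : ∫ x, (blockCurrent ω₂ lam β γ N k₁ k₂ x - poisson ((pinnedChain ω₂ lam β γ).hamiltonian N) G x) ^ 2 ∂μ =
        (L / M) ^ 2 * ∫ x, (blockCurrent ω₂ lam β γ N k₂ (k₂ + M) x) ^ 2 ∂μ := by
      rw [← integral_const_mul]; exact integral_congr_ae (Eventually.of_forall fun x => by simp only [hPo]; ring)
    rw [e]
    have hM1' : (1 : ℝ) ≤ M := Nat.one_le_cast.mpr hM1; have hτ0 : 0 ≤ τ := by linarith only [hτ]
    have h3 : τ / M ≤ 2 := by rw [div_le_iff₀ hMpos]; linarith only [hτM, hM1']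
    have hP0 : 0 ≤ L ^ 2 * (DJ * Z) := by positivity
    have h4 := mul_le_mul_of_nonneg_left (mul_le_mul_of_nonneg_left hJ2 (sq_nonneg (L / M)))
      (by positivity : (0 : ℝ) ≤ 2 * τ ^ 2)
    have e2 : 2 * τ ^ 2 * ((L / M) ^ 2 * (DJ * M * Z)) = (τ / M) * τ * (2 * (L ^ 2 * (DJ * Z))) := by field_simp
    have h5 : (τ / M) * τ * (2 * (L ^ 2 * (DJ * Z))) ≤ 2 * τ * (2 * (L ^ 2 * (DJ * Z))) := by gcongr
    linarith only [h4, e2, h5, mul_nonneg hL0 hP0]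
  exact (add_le_add hvar hdefect).trans_eq (by ring)

end Summit.AtomisticToContinuum.FouriersLaw.Theorems.SubBallisticWindow.RampCorrector
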